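import Summits.QuantumFields.YangMills.Theorems.FlatTubeReductionProfileLevelSetVolume
import Summits.QuantumFields.YangMills.Theorems.FlatTubeReductionReferenceDensityDomination
import HarnessLib

/-!
# The FLOOR of the reference weight and of the kernel ratio on the core box: `∫_A Ω·fpWeight·Ω dμP ≥ fpZ ε·(ρ³/10)^{|Λ|−1}·(∫_C Ω dπ)²` on
# `A = {kinDefect(oT 1 v, oT 1 v′, g) ≤ |E|(2ρ + √2‖v̂‖ + √2‖v̂′‖)²} ∩ (C × C × G)`, and `σ₁ ≥ e^{−(explicit)}` there
# (route `FlatTubeReduction`, crux K1 `NearFlatRatioLaw` stmt-QuantumFields-24720; seat `ym-line-ftr-p1` g12; rate twin «ratepack-v3 / frozen fibres»; R2b1 RECORD rung — no summit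
# statement is proved here)

WHY (memo `Cruxes/NearFlatRatioLaw/Lines/ratepack-v3-frozen-g12.md` §§5.7–5.8, brick (viii-c), floor side).  The floor-set hypotheses `hv : v ≤ ∫_A F dμ` and `hσA : σ ≥ c₁ on A` of
`…GaussianLayerCakeWeighted.moment_ratio_le_weighted` for the (T)-diagonal: `A` is the kinetic level set at the (v, v′)-dependent level `|E|(2ρ + √2‖v̂‖ + √2‖v̂′‖)²` over a fibre core
`C` (any measurable set of capped fibres); the gauge integral is `…FPLevelSetVolume.integral_fpWeight_kinLevelSet_ge`, the fibre part is the PROFILE MASS `∫_C Ω dπ` squared (θ(Ω) of the memo),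
and on `A` the kernel ratio `σ₁ = K/K₁(1,1) = exp(−β·kinDefect − (β/2)(S + S′))` is bounded below explicitly (lane A's `wilsonAction_orthoTube_one_le`).
* ★★ `setIntegral_profile_kinLevelSet_ge` — the floor mass;  ★ `kernelRatio_ge_on_levelSet` — the floor value of `σ₁`.
HONEST FRAMING: Fubini bookkeeping; femto rung R2b1 (RECORD label); not infinite volume, not a gap, not Clay.  No defs, no named facts, no `sorry`.
-/

set_option autoImplicit false

noncomputable section

open MeasureTheory Filter Topology Real Set
open scoped BigOperators ENNReal
open Literature.MathematicalPhysics.QuantumFieldTheory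
open Literature.MathematicalPhysics.QuantumLattice

namespace Summit.QuantumFields.YangMills.Theorems.FemtoTransferGap.RateTube

open Summit.QuantumFields.YangMills.Theorems.FemtoTransferGap
open Summit.QuantumFields.YangMills.Theorems.FemtoTransferGap.TwoLattice
open Summit.QuantumFields.YangMills.Theorems.FemtoTransferGap.TwoLattice.ConstTube
open Summit.QuantumFields.YangMills.Theorems.FemtoTransferGap.TwoLattice.Avg
open Summit.QuantumFields.YangMills.Theorems.FemtoTransferGap.TwoLattice.Cov
open Summit.QuantumFields.YangMills.Theorems.FemtoTransferGap.TwoLattice.Stiff (LinkSpace)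

variable {L : ℕ} [NeZero L]

/-! ## §1 ★ The kernel ratio on a level set of the vacuum pair -/

/-- ★ **`σ₁ ≥ e^{−βD − (β/2)(100N_P(‖v̂‖² + ‖v̂′‖²) + 2E(t,0))}` on `{kinDefect ≤ D}`** for balanced capped fibres with `|v_{e,c}|, |v′_{e,c}| ≤ t ≤ 1/30`.
[cite: Luscher1983, §3] -/
theorem kernelRatio_ge_on_levelSet {β : ℝ} (hβ : 0 ≤ β) {v v' : Edge 3 L → Fin 3 → ℝ} (hv : v ∈ capBalancedSet L) (hv' : v' ∈ capBalancedSet L) {t : ℝ} (ht : t ≤ 1 / 30)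
    (hvt : ∀ (e : Edge 3 L) (c : Fin 3), |v e c| ≤ t) (hv't : ∀ (e : Edge 3 L) (c : Fin 3), |v' e c| ≤ t) {D : ℝ} {g : Site 3 L → SU2}
    (hD : kinDefect L (orthoTube L 1 v) (orthoTube L 1 v') g ≤ D) :
    Real.exp (-(β * D) - β / 2 * (((10 * Real.sqrt (Fintype.card (Plaquette 3 L × Fin 3)) * ‖linkEmbed L v‖) ^ 2 + stepActionErr (L := L) t 0) +
        ((10 * Real.sqrt (Fintype.card (Plaquette 3 L × Fin 3)) * ‖linkEmbed L v'‖) ^ 2 + stepActionErr (L := L) t 0))) ≤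
      transferKernel su2Rep β (orthoTube L 1 v) (gaugeTransform g (orthoTube L 1 v')) / transferKernel su2Rep ((L : ℝ) ^ 3 * β) (1 : GaugeConfig 3 1 SU2) 1 := by
  have hK1 := transferKernel_one_site_one_one_cube (L := L) β
  have hK1p : 0 < transferKernel su2Rep ((L : ℝ) ^ 3 * β) (1 : GaugeConfig 3 1 SU2) 1 := transferKernel_pos _ _ _ _
  rw [le_div_iff₀ hK1p, hK1, ← Real.exp_add, transferKernel_gaugeTransform_eq]
  refine Real.exp_le_exp.mpr ?_
  have hS := wilsonAction_orthoTube_one_le hv ht hvt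
  have hS' := wilsonAction_orthoTube_one_le hv' ht hv't
  nlinarith [mul_le_mul_of_nonneg_left hS (by positivity : 0 ≤ β / 2), mul_le_mul_of_nonneg_left hS' (by positivity : 0 ≤ β / 2), mul_le_mul_of_nonneg_left hD hβ]

/-! ## §2 ★★ The floor mass of the reference weight -/

set_option maxHeartbeats 400000 in
/-- ★★ **Floor mass.**  `Ω ≥ 0` bounded measurable with support in the capped balanced set, `C ⊆ {‖v̂‖ ≤ r₀}` a measurable set of fibres, `0 < ρ ≤ 1`, and the CONSTANT level
`D₀ = |E|(2ρ + 2√2r₀)²`: `fpZ ε·(ρ³/10)^{|Λ|−1}·(∫_C Ω dπ)² ≤ ∫_{ {kinDefect(oT 1 v, oT 1 v′, g) ≤ D₀} ∩ (C × C × G) } Ω(v̂)·fpWeight ε(g)·Ω(v̂′) dμP`. [cite: Luscher1983, §3] -/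
theorem setIntegral_profile_kinLevelSet_ge {Ω : LinkSpace L → ℝ} (hΩm : Measurable Ω) {CΩ : ℝ} (hCΩ : ∀ x, |Ω x| ≤ CΩ) (hΩ0 : ∀ x, 0 ≤ Ω x)
    (hΩt : ∀ v : Edge 3 L → Fin 3 → ℝ, Ω (linkEmbed L v) ≠ 0 → v ∈ capBalancedSet L) {C : Set (Edge 3 L → Fin 3 → ℝ)} (hC : MeasurableSet C) {r₀ : ℝ}
    (hCr : ∀ v ∈ C, ‖linkEmbed L v‖ ≤ r₀) (ε : ℝ) {ρ : ℝ} (hρ : 0 < ρ) (hρ1 : ρ ≤ 1) :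
    fpZ ε * (ρ ^ 3 / 10) ^ Fintype.card {x : Site 3 L // ¬x = 0} * (∫ v in C, Ω (linkEmbed L v) ∂orthoTransverse L) ^ 2 ≤
      ∫ p in {p : (Edge 3 L → Fin 3 → ℝ) × ((Edge 3 L → Fin 3 → ℝ) × (Site 3 L → SU2)) |
          kinDefect L (orthoTube L 1 p.1) (orthoTube L 1 p.2.1) p.2.2 ≤ (Fintype.card (Edge 3 L) : ℝ) * (2 * ρ + 2 * Real.sqrt 2 * r₀) ^ 2} ∩ C ×ˢ (C ×ˢ Set.univ),
        Ω (linkEmbed L p.1) * (fpWeight L ε p.2.2 * Ω (linkEmbed L p.2.1)) ∂((orthoTransverse L).prod ((orthoTransverse L).prod (gaugeMeasure L))) := by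
  haveI := isFiniteMeasure_orthoTransverse L
  haveI : SecondCountableTopology SU2 := secondCountableTopology_su2
  set n : ℕ := Fintype.card {x : Site 3 L // ¬x = 0} with hn
  set D₀ : ℝ := (Fintype.card (Edge 3 L) : ℝ) * (2 * ρ + 2 * Real.sqrt 2 * r₀) ^ 2 with hD₀
  have hle : Measurable (linkEmbed L) := measurable_linkEmbed L
  have hfw : Measurable (fpWeight L ε) := measurable_fpWeight L ε
  have hCΩ0 : 0 ≤ CΩ := (abs_nonneg _).trans (hCΩ 0)
  have hZ0 : 0 ≤ fpZ ε := by unfold fpZ; exact measureReal_nonneg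
  -- the sets
  set S : Set ((Edge 3 L → Fin 3 → ℝ) × ((Edge 3 L → Fin 3 → ℝ) × (Site 3 L → SU2))) :=
    {p | kinDefect L (orthoTube L 1 p.1) (orthoTube L 1 p.2.1) p.2.2 ≤ D₀} with hS
  have hSm : MeasurableSet S := measurableSet_tubeKinLevelSet (L := L) D₀
  have hPm : MeasurableSet (C ×ˢ (C ×ˢ (Set.univ : Set (Site 3 L → SU2)))) := hC.prod (hC.prod MeasurableSet.univ)
  have hAm : MeasurableSet (S ∩ C ×ˢ (C ×ˢ (Set.univ : Set (Site 3 L → SU2)))) := hSm.inter hPm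
  -- the integrand
  set F : (Edge 3 L → Fin 3 → ℝ) × ((Edge 3 L → Fin 3 → ℝ) × (Site 3 L → SU2)) → ℝ := fun p => Ω (linkEmbed L p.1) * (fpWeight L ε p.2.2 * Ω (linkEmbed L p.2.1)) with hF
  have hFm : Measurable F := by
    have a1 : Measurable fun p : (Edge 3 L → Fin 3 → ℝ) × ((Edge 3 L → Fin 3 → ℝ) × (Site 3 L → SU2)) => Ω (linkEmbed L p.1) := hΩm.comp (hle.comp measurable_fst)
    have a2 : Measurable fun p : (Edge 3 L → Fin 3 → ℝ) × ((Edge 3 L → Fin 3 → ℝ) × (Site 3 L → SU2)) => fpWeight L ε p.2.2 := hfw.comp (measurable_snd.comp measurable_snd)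
    have a3 : Measurable fun p : (Edge 3 L → Fin 3 → ℝ) × ((Edge 3 L → Fin 3 → ℝ) × (Site 3 L → SU2)) => Ω (linkEmbed L p.2.1) :=
      hΩm.comp (hle.comp (measurable_fst.comp measurable_snd))
    exact a1.mul (a2.mul a3)
  have hF0 : ∀ p, 0 ≤ F p := fun p => mul_nonneg (hΩ0 _) (mul_nonneg (fpWeight_mem_Icc L ε _).1 (hΩ0 _))
  have hFb : ∀ p, F p ≤ CΩ * CΩ := fun p => by
    calc Ω (linkEmbed L p.1) * (fpWeight L ε p.2.2 * Ω (linkEmbed L p.2.1)) ≤ CΩ * (1 * CΩ) :=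
          mul_le_mul ((le_abs_self _).trans (hCΩ _)) (mul_le_mul (fpWeight_mem_Icc L ε _).2 ((le_abs_self _).trans (hCΩ _)) (hΩ0 _) zero_le_one)
            (mul_nonneg (fpWeight_mem_Icc L ε _).1 (hΩ0 _)) hCΩ0
      _ = CΩ * CΩ := by ring
  set Φ : (Edge 3 L → Fin 3 → ℝ) × ((Edge 3 L → Fin 3 → ℝ) × (Site 3 L → SU2)) → ℝ := (S ∩ C ×ˢ (C ×ˢ (Set.univ : Set (Site 3 L → SU2)))).indicator F with hΦ
  have hΦm : Measurable Φ := hFm.indicator hAm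
  have hΦ0 : ∀ p, 0 ≤ Φ p := fun p => Set.indicator_nonneg (fun q _ => hF0 q) _
  have hΦb : ∀ p, |Φ p| ≤ CΩ * CΩ := fun p => by
    rw [abs_of_nonneg (hΦ0 p), hΦ]
    exact (Set.indicator_le_self' (fun q _ => hF0 q) p).trans (hFb p)
  have hΦi : Integrable Φ ((orthoTransverse L).prod ((orthoTransverse L).prod (gaugeMeasure L))) := integrable_of_measurable_abs_le _ hΦm hΦb
  rw [← integral_indicator hAm]
  change _ ≤ ∫ p, Φ p ∂(orthoTransverse L).prod ((orthoTransverse L).prod (gaugeMeasure L))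
  rw [integral_prod _ hΦi]
  -- the fibre weight `G = 𝟙_C·Ω∘linkEmbed`
  set G : (Edge 3 L → Fin 3 → ℝ) → ℝ := fun v => C.indicator (fun v => Ω (linkEmbed L v)) v with hG
  have hGm : Measurable G := (hΩm.comp hle).indicator hC
  have hG0 : ∀ v, 0 ≤ G v := fun v => Set.indicator_nonneg (fun w _ => hΩ0 _) _
  have hGb : ∀ v, |G v| ≤ CΩ := fun v => by
    rw [abs_of_nonneg (hG0 v), hG]
    exact (Set.indicator_le_self' (fun w _ => hΩ0 _) v).trans ((le_abs_self _).trans (hCΩ _))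
  have hGi : Integrable G (orthoTransverse L) := integrable_of_measurable_abs_le _ hGm hGb
  have hGint : ∫ v, G v ∂orthoTransverse L = ∫ v in C, Ω (linkEmbed L v) ∂orthoTransverse L := by rw [hG, integral_indicator hC]
  have hsec : ∀ v : Edge 3 L → Fin 3 → ℝ, Integrable (fun q : (Edge 3 L → Fin 3 → ℝ) × (Site 3 L → SU2) => Φ (v, q)) ((orthoTransverse L).prod (gaugeMeasure L)) := fun v =>
    integrable_of_measurable_abs_le _ (hΦm.comp measurable_prodMk_left) fun q => hΦb (v, q)
  -- the pointwise form of `Φ` on a fibre pair in `C × C`, and off it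
  have hΦin : ∀ (v v' : Edge 3 L → Fin 3 → ℝ) (g : Site 3 L → SU2), v ∈ C → v' ∈ C →
      Φ (v, (v', g)) = Ω (linkEmbed L v) * Ω (linkEmbed L v') * (fpWeight L ε g * Set.indicator {g : Site 3 L → SU2 | kinDefect L (orthoTube L 1 v) (orthoTube L 1 v') g ≤ D₀} (fun _ => (1 : ℝ)) g) := by
    intro v v' g hvC hv'C
    have hmemP : ((v, (v', g)) : (Edge 3 L → Fin 3 → ℝ) × ((Edge 3 L → Fin 3 → ℝ) × (Site 3 L → SU2))) ∈ C ×ˢ (C ×ˢ (Set.univ : Set (Site 3 L → SU2))) :=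
      Set.mk_mem_prod hvC (Set.mk_mem_prod hv'C (Set.mem_univ g))
    by_cases hk : kinDefect L (orthoTube L 1 v) (orthoTube L 1 v') g ≤ D₀
    · have hmemS : ((v, (v', g)) : (Edge 3 L → Fin 3 → ℝ) × ((Edge 3 L → Fin 3 → ℝ) × (Site 3 L → SU2))) ∈ S := by rw [hS]; exact hk
      rw [hΦ, Set.indicator_of_mem (Set.mem_inter hmemS hmemP), Set.indicator_of_mem (by exact hk : g ∈ {g : Site 3 L → SU2 | kinDefect L (orthoTube L 1 v) (orthoTube L 1 v') g ≤ D₀}), hF]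
      ring
    · have hnS : ((v, (v', g)) : (Edge 3 L → Fin 3 → ℝ) × ((Edge 3 L → Fin 3 → ℝ) × (Site 3 L → SU2))) ∉ S ∩ C ×ˢ (C ×ˢ (Set.univ : Set (Site 3 L → SU2))) := by
        intro h; apply hk; have h1 := h.1; rw [hS] at h1; exact h1
      rw [hΦ, Set.indicator_of_notMem hnS, Set.indicator_of_notMem (by exact hk : g ∉ {g : Site 3 L → SU2 | kinDefect L (orthoTube L 1 v) (orthoTube L 1 v') g ≤ D₀})]
      ring
  -- the inner g-integral from below
  have hinner_g : ∀ (v v' : Edge 3 L → Fin 3 → ℝ), G v * G v' * (fpZ ε * (ρ ^ 3 / 10) ^ n) ≤ ∫ g, Φ (v, (v', g)) ∂gaugeMeasure L := by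
    intro v v'
    by_cases hvC : v ∈ C
    swap
    · rw [show G v = 0 from Set.indicator_of_notMem hvC _, zero_mul, zero_mul]
      exact integral_nonneg fun g => hΦ0 _
    by_cases hv'C : v' ∈ C
    swap
    · rw [show G v' = 0 from Set.indicator_of_notMem hv'C _, mul_zero, zero_mul]
      exact integral_nonneg fun g => hΦ0 _
    rw [show G v = Ω (linkEmbed L v) from Set.indicator_of_mem hvC _, show G v' = Ω (linkEmbed L v') from Set.indicator_of_mem hv'C _]
    rw [integral_congr_ae (ae_of_all _ fun g => hΦin v v' g hvC hv'C), integral_const_mul]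
    have hΩΩ0 : 0 ≤ Ω (linkEmbed L v) * Ω (linkEmbed L v') := mul_nonneg (hΩ0 _) (hΩ0 _)
    by_cases hz : Ω (linkEmbed L v) * Ω (linkEmbed L v') = 0
    · rw [hz, zero_mul, zero_mul]
    · have hvne : Ω (linkEmbed L v) ≠ 0 := fun h => hz (by rw [h, zero_mul])
      have hv'ne : Ω (linkEmbed L v') ≠ 0 := fun h => hz (by rw [h, mul_zero])
      have hv1 : ∀ e : Edge 3 L, ∑ a, v e a ^ 2 ≤ 1 := sum_sq_le_one_of_cap L (hΩt v hvne).2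
      have hv'1 : ∀ e : Edge 3 L, ∑ a, v' e a ^ 2 ≤ 1 := sum_sq_le_one_of_cap L (hΩt v' hv'ne).2
      have ha : ∀ e, ‖su2Quat (orthoTube L 1 v e) - 1‖ ≤ Real.sqrt 2 * r₀ := fun e => by
        have h := norm_su2Quat_orthoTube_sub_one_le (1 : GaugeConfig 3 1 SU2) hv1 e
        rw [Pi.one_apply, su2Quat_one, sub_self, norm_zero, add_zero] at h
        exact h.trans (mul_le_mul_of_nonneg_left (hCr v hvC) (Real.sqrt_nonneg _))
      have ha' : ∀ e, ‖su2Quat (orthoTube L 1 v' e) - 1‖ ≤ Real.sqrt 2 * r₀ := fun e => by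
        have h := norm_su2Quat_orthoTube_sub_one_le (1 : GaugeConfig 3 1 SU2) hv'1 e
        rw [Pi.one_apply, su2Quat_one, sub_self, norm_zero, add_zero] at h
        exact h.trans (mul_le_mul_of_nonneg_left (hCr v' hv'C) (Real.sqrt_nonneg _))
      have h := integral_fpWeight_kinLevelSet_ge (L := L) ε (orthoTube L 1 v) (orthoTube L 1 v') ha ha' hρ hρ1
      have eD : (Fintype.card (Edge 3 L) : ℝ) * (2 * ρ + Real.sqrt 2 * r₀ + Real.sqrt 2 * r₀) ^ 2 = D₀ := by rw [hD₀]; ring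
      rw [eD] at h
      exact mul_le_mul_of_nonneg_left h hΩΩ0
  -- integrate in v′ and v
  have hstep : ∀ v : Edge 3 L → Fin 3 → ℝ, G v * (fpZ ε * (ρ ^ 3 / 10) ^ n) * ∫ v', G v' ∂orthoTransverse L ≤ ∫ q, Φ (v, q) ∂(orthoTransverse L).prod (gaugeMeasure L) := by
    intro v
    rw [integral_prod _ (hsec v), ← integral_const_mul]
    have hI1 : Integrable (fun v' => ∫ g, Φ (v, (v', g)) ∂gaugeMeasure L) (orthoTransverse L) := (hsec v).integral_prod_left
    refine integral_mono (hGi.const_mul _) hI1 fun v' => ?_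
    have h := hinner_g v v'
    calc G v * (fpZ ε * (ρ ^ 3 / 10) ^ n) * G v' = G v * G v' * (fpZ ε * (ρ ^ 3 / 10) ^ n) := by ring
      _ ≤ ∫ g, Φ (v, (v', g)) ∂gaugeMeasure L := h
  have hJ1 : Integrable (fun v => ∫ q, Φ (v, q) ∂(orthoTransverse L).prod (gaugeMeasure L)) (orthoTransverse L) := hΦi.integral_prod_left
  calc fpZ ε * (ρ ^ 3 / 10) ^ n * (∫ v in C, Ω (linkEmbed L v) ∂orthoTransverse L) ^ 2
      = ∫ v, G v * (fpZ ε * (ρ ^ 3 / 10) ^ n) * ∫ v', G v' ∂orthoTransverse L ∂orthoTransverse L := by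
        rw [integral_mul_const, integral_mul_const, hGint]; ring
    _ ≤ ∫ v, ∫ q, Φ (v, q) ∂(orthoTransverse L).prod (gaugeMeasure L) ∂orthoTransverse L := integral_mono ((hGi.mul_const _).mul_const _) hJ1 hstep

end Summit.QuantumFields.YangMills.Theorems.FemtoTransferGap.RateTube

end
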